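import Summits.ValiantsHypothesis.ValiantsHypothesis.Theorems.KPlusLogSqLawOctaveScalesClusters

/-!
# Route «KPlusLogSqLaw», octave line — the GERM of Conjecture B at `x = 1` (val-idea-6 v6): `kPlusLogSqLaw_iff_nearOneKLaw`

HONEST FRAMING.  Octave line of ideator seat val-idea-6 (crux-idea `octave-lifting` on stmt-ValiantsHypothesis-19561), v6 germ block
of the deposit `Cruxes/WeakLifting/Lines/octave.lean` (commit 5916e05419e3, §«The germ at x = 1»), landed in Theorems shape by prover
seat val-width-19561-oc1 (g2), `--supports stmt-ValiantsHypothesis-19561`.  Conjecture B (`KPlusLogSqLaw`), `TropicalB` (stmt-19771),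
`WeakLifting` (stmt-19561) and the octave statements are OPEN; the near-one law `NearOneKLaw ε` is DEFINED, NOT asserted — this file
proves only that it is EQUIVALENT to Conjecture B for every `ε > 0`.  Nothing here bears on the truth of B; VP ≠ VNP is not moved.

CONTENT.  `PosRootLawAt m K P` (≤ `P` distinct positive roots), `NearOneRootLawAt m K ε P` (≤ `P` distinct roots in `[1, 1 + ε)`),
`NearOneKLaw ε`; `card_neg_roots_le_of_pos` / `realRootLawAt_of_pos` (`Z ≤ 2P + 1` via `scalePencil (−1)`);
`posRootLawAt_of_nearOne` — the mechanism: the degree DILATION `d ↦ q·d` (`dilate`, `eval_pencilDet_dilate`: `f_{q d}(u) = f_d(u^q)`)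
with `q > 2A / log₂(1+ε)`, `A = Σ ⌈|log₂ t|⌉` over the positive roots `t`, followed by the centring `x ↦ 2^{A/q} x`
(`scalePencil 2^{−A/q}`), maps ALL positive roots injectively into `[1, 1 + ε)`, format and symmetry unchanged; hence
`kPlusLogSqLaw_iff_nearOneKLaw : 0 < ε → (KPlusLogSqLaw ↔ NearOneKLaw ε)` (`C ↦ C + 2`).  Reading for the LOCAL lens (val-idea-4):
Conjecture B is a statement about an arbitrarily small right-neighbourhood of `x = 1` (DISTINCT roots there); `LocalRootLawAt`
(multiplicity AT 1) is its coalesced shadow.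
-/

set_option linter.dupNamespace false
set_option autoImplicit false

namespace Summit.ValiantsHypothesis.ValiantsHypothesis.Theorems.KPlusLogSqLaw.Octave

open Polynomial Finset
open scoped BigOperators
open Summit.ValiantsHypothesis.ValiantsHypothesis.Theorems.LacunarySymmetroidMatrixDescartes (RealRootLawAt KPlusLogSqLaw)

section Germ

/-- positive-root census row: at most `P` distinct positive real roots. -/
def PosRootLawAt (m K P : ℕ) : Prop :=
  ∀ (d : Fin K → ℕ) (S : Fin K → Matrix (Fin m) (Fin m) ℝ), (∀ l, (S l).IsSymm) →
    ((pencilDet d S).roots.toFinset.filter (fun x => 0 < x)).card ≤ P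

/-- near-one census row with window `ε`: at most `P` distinct real roots in `[1, 1 + ε)`. -/
def NearOneRootLawAt (m K : ℕ) (ε : ℝ) (P : ℕ) : Prop :=
  ∀ (d : Fin K → ℕ) (S : Fin K → Matrix (Fin m) (Fin m) ℝ), (∀ l, (S l).IsSymm) →
    ((pencilDet d S).roots.toFinset.filter (fun x => 1 ≤ x ∧ x < 1 + ε)).card ≤ P

/-- the near-one `K + log² m` law with window `ε` (NOT asserted). -/
def NearOneKLaw (ε : ℝ) : Prop := ∃ C : ℕ, ∀ m K : ℕ, NearOneRootLawAt m K ε (2 ^ (C * (K + Nat.log 2 m ^ 2)))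

/-- negative roots of `f` are positive roots of `u ↦ f(−u)`: a positive-root row bounds negative roots too. [folklore] -/
theorem card_neg_roots_le_of_pos {m K P : ℕ} (h : PosRootLawAt m K P) (d : Fin K → ℕ)
    (S : Fin K → Matrix (Fin m) (Fin m) ℝ) (hS : ∀ l, (S l).IsSymm) :
    ((pencilDet d S).roots.toFinset.filter (fun x => x < 0)).card ≤ P := by
  classical
  have hb := h d (scalePencil (-1) d S) (scalePencil_isSymm (-1) d S hS)
  refine le_trans ?_ hb
  apply Finset.card_le_card_of_injOn (fun x => -x)
  · intro x hx
    rw [Finset.mem_coe, mem_filter, Multiset.mem_toFinset] at hx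
    obtain ⟨hxr, hx0⟩ := hx
    have hp : pencilDet d S ≠ 0 := (mem_roots'.1 hxr).1
    have hroot : (pencilDet d S).IsRoot x := (mem_roots'.1 hxr).2
    rw [Finset.mem_coe, mem_filter, Multiset.mem_toFinset,
      mem_roots (pencilDet_scale_ne_zero (-1) (by norm_num) d S hp), IsRoot, eval_pencilDet_scale]
    refine ⟨by simpa using hroot, by linarith⟩
  · intro x _ y _ hxy; simpa using hxy

/-- **positive row ⇒ real row**: `Z ≤ 2P + 1`. [folklore] -/
theorem realRootLawAt_of_pos {m K P : ℕ} (h : PosRootLawAt m K P) : RealRootLawAt m K (2 * P + 1) := by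
  classical
  intro d S hS
  set R := (Matrix.det (∑ l, ((Polynomial.X : Polynomial ℝ) ^ d l) • (S l).map Polynomial.C)).roots.toFinset with hR
  have hR' : R = (pencilDet d S).roots.toFinset := rfl
  have hsub : R ⊆ (R.filter (fun x => 0 < x) ∪ R.filter (fun x => x < 0)) ∪ {0} := by
    intro x hx
    rcases lt_trichotomy x 0 with hl | he | hg
    · exact mem_union_left _ (mem_union_right _ (mem_filter.2 ⟨hx, hl⟩))
    · exact mem_union_right _ (by simp [he])
    · exact mem_union_left _ (mem_union_left _ (mem_filter.2 ⟨hx, hg⟩))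
  have h1 := h d S hS
  have h2 := card_neg_roots_le_of_pos h d S hS
  rw [← hR'] at h1 h2
  calc R.card ≤ ((R.filter (fun x => 0 < x) ∪ R.filter (fun x => x < 0)) ∪ {0}).card := card_le_card hsub
    _ ≤ (R.filter (fun x => 0 < x) ∪ R.filter (fun x => x < 0)).card + ({0} : Finset ℝ).card := card_union_le _ _
    _ ≤ ((R.filter (fun x => 0 < x)).card + (R.filter (fun x => x < 0)).card) + 1 :=
        Nat.add_le_add (card_union_le _ _) (by simp)
    _ ≤ 2 * P + 1 := by omega

/-- **near-one row ⇒ positive row** (v6): a dilation `d ↦ q·d` with `q > 2A / log₂(1+ε)` followed by the centring `x ↦ 2^{A/q} x`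
maps ALL positive roots (scales in `[2^{-A}, 2^{A}]`) injectively into `[1, 1 + ε)`, format and symmetry unchanged. [folklore] -/
theorem posRootLawAt_of_nearOne {m K P : ℕ} {ε : ℝ} (hε : 0 < ε) (h : NearOneRootLawAt m K ε P) : PosRootLawAt m K P := by
  classical
  intro d S hS
  set R := (pencilDet d S).roots.toFinset.filter (fun x => 0 < x) with hR
  set A : ℕ := ∑ t ∈ R, ⌈|Real.logb 2 t|⌉₊ with hA
  have hwin : ∀ t ∈ R, |Real.logb 2 t| ≤ A := by
    intro t ht
    calc |Real.logb 2 t| ≤ (⌈|Real.logb 2 t|⌉₊ : ℝ) := Nat.le_ceil _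
      _ ≤ ((∑ t ∈ R, ⌈|Real.logb 2 t|⌉₊ : ℕ) : ℝ) := by
          exact_mod_cast Finset.single_le_sum (f := fun t => ⌈|Real.logb 2 t|⌉₊) (fun _ _ => Nat.zero_le _) ht
  have hL : 0 < Real.logb 2 (1 + ε) := Real.logb_pos (by norm_num) (by linarith)
  obtain ⟨q₀, hq₀⟩ := exists_nat_gt (2 * (A : ℝ) / Real.logb 2 (1 + ε))
  set q : ℕ := q₀ + 1 with hq
  have hq0 : 0 < q := by omega
  have hqR : (0 : ℝ) < q := by exact_mod_cast hq0
  have hqgt : 2 * (A : ℝ) / Real.logb 2 (1 + ε) < q := by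
    rw [hq]; push_cast; linarith
  have hAq : 2 * (A : ℝ) * (q : ℝ)⁻¹ < Real.logb 2 (1 + ε) := by
    rw [← div_eq_mul_inv, div_lt_iff₀ hqR]
    rw [div_lt_iff₀ hL] at hqgt
    linarith
  set β : ℝ := (A : ℝ) * (q : ℝ)⁻¹ with hβ
  set c : ℝ := (2 : ℝ) ^ (-β) with hc
  have hc0 : 0 < c := Real.rpow_pos_of_pos (by norm_num) _
  set S' := scalePencil c (dilate q d) S with hS'
  have hb := h (dilate q d) S' (scalePencil_isSymm c _ S hS)
  refine le_trans ?_ hb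
  let f : ℝ → ℝ := fun t => (2 : ℝ) ^ β * t ^ ((q : ℝ)⁻¹)
  have hcf : ∀ t, 0 ≤ t → (c * f t) ^ q = t := by
    intro t ht
    have : c * (2 : ℝ) ^ β = 1 := by
      rw [hc, ← Real.rpow_add (by norm_num : (0 : ℝ) < 2)]; simp
    show (c * ((2 : ℝ) ^ β * t ^ ((q : ℝ)⁻¹))) ^ q = t
    rw [← mul_assoc, this, one_mul, Real.rpow_inv_natCast_pow ht hq0.ne']
  apply Finset.card_le_card_of_injOn f
  · intro t ht
    rw [Finset.mem_coe, hR, mem_filter, Multiset.mem_toFinset] at ht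
    obtain ⟨htr, ht0⟩ := ht
    have hp : pencilDet d S ≠ 0 := (mem_roots'.1 htr).1
    have hroot : (pencilDet d S).IsRoot t := (mem_roots'.1 htr).2
    have hp' : pencilDet (dilate q d) S' ≠ 0 :=
      pencilDet_scale_ne_zero c hc0.ne' _ S (pencilDet_dilate_ne_zero q hq0 d S hp)
    rw [Finset.mem_coe, mem_filter, Multiset.mem_toFinset, mem_roots hp', IsRoot, hS', eval_pencilDet_scale,
      eval_pencilDet_dilate, hcf t ht0.le]
    refine ⟨hroot, ?_⟩
    have hft : 0 < f t := mul_pos (Real.rpow_pos_of_pos (by norm_num) _) (Real.rpow_pos_of_pos ht0 _)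
    have hlog : Real.logb 2 (f t) = β + (q : ℝ)⁻¹ * Real.logb 2 t := by
      show Real.logb 2 ((2 : ℝ) ^ β * t ^ ((q : ℝ)⁻¹)) = _
      rw [Real.logb_mul (Real.rpow_pos_of_pos (by norm_num) _).ne' (Real.rpow_pos_of_pos ht0 _).ne',
        Real.logb_rpow (by norm_num) (by norm_num), Real.logb_rpow_eq_mul_logb_of_pos ht0]
    have hw := hwin t (by rw [hR, mem_filter, Multiset.mem_toFinset]; exact ⟨htr, ht0⟩)
    have habs := abs_le.1 hw
    have hqi : (0 : ℝ) < (q : ℝ)⁻¹ := inv_pos.2 hqR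
    have hlo : 0 ≤ Real.logb 2 (f t) := by
      rw [hlog, hβ]; nlinarith [habs.1, hqi]
    have hhi : Real.logb 2 (f t) < Real.logb 2 (1 + ε) := by
      rw [hlog, hβ]; nlinarith [habs.2, hqi, hAq]
    constructor
    · exact (Real.logb_nonneg_iff (by norm_num : (1:ℝ) < 2) hft).1 hlo
    · exact (Real.logb_lt_logb_iff (by norm_num : (1:ℝ) < 2) hft (by linarith)).1 hhi
  · intro t₁ ht₁ t₂ ht₂ hft
    rw [Finset.mem_coe, hR, mem_filter] at ht₁ ht₂
    have e1 := hcf t₁ ht₁.2.le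
    have e2 := hcf t₂ ht₂.2.le
    have : f t₁ = f t₂ := hft
    rw [← e1, ← e2, this]

/-- B ⇒ near-one law (restriction). [folklore] -/
theorem nearOneKLaw_of_kPlusLogSqLaw (ε : ℝ) (h : KPlusLogSqLaw) : NearOneKLaw ε := by
  obtain ⟨C, hC⟩ := h
  exact ⟨C, fun m K d S hS => (Finset.card_filter_le _ _).trans (hC m K d S hS)⟩

/-- near-one law ⇒ B (`C ↦ C + 2`). [folklore] -/
theorem kPlusLogSqLaw_of_nearOneKLaw {ε : ℝ} (hε : 0 < ε) (h : NearOneKLaw ε) : KPlusLogSqLaw := by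
  obtain ⟨C, hC⟩ := h
  refine ⟨C + 2, fun m K => ?_⟩
  have hrow := realRootLawAt_of_pos (posRootLawAt_of_nearOne hε (hC m K))
  rcases Nat.eq_zero_or_pos (K + Nat.log 2 m ^ 2) with hE | hE
  · have hK : K = 0 := by omega
    subst hK
    intro d S _
    have h0 : (∑ l : Fin 0, ((Polynomial.X : Polynomial ℝ) ^ d l) • (S l).map Polynomial.C) = 0 := by simp
    rw [h0]
    rcases Nat.eq_zero_or_pos m with hm | hm
    · subst hm; simp [Matrix.det_isEmpty]
    · haveI : Nonempty (Fin m) := ⟨⟨0, hm⟩⟩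
      simp [Matrix.det_zero]
  · refine Summit.ValiantsHypothesis.ValiantsHypothesis.Theorems.LacunarySymmetroidMatrixDescartes.Census.realRootLawAt_mono ?_ hrow
    set E := K + Nat.log 2 m ^ 2
    have hx : 1 ≤ 2 ^ (C * E) := Nat.one_le_two_pow
    calc 2 * 2 ^ (C * E) + 1 ≤ 2 ^ (C * E + 2) := by rw [pow_add]; omega
      _ ≤ 2 ^ ((C + 2) * E) := Nat.pow_le_pow_right (by norm_num) (by nlinarith)

/-- **B equals its germ at `x = 1`** (v6): for every `ε > 0`, Conjecture B ⟺ the same `K + log² m` budget for roots in `[1, 1 + ε)`. [folklore] -/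
theorem kPlusLogSqLaw_iff_nearOneKLaw {ε : ℝ} (hε : 0 < ε) : KPlusLogSqLaw ↔ NearOneKLaw ε :=
  ⟨nearOneKLaw_of_kPlusLogSqLaw ε, kPlusLogSqLaw_of_nearOneKLaw hε⟩

end Germ

end Summit.ValiantsHypothesis.ValiantsHypothesis.Theorems.KPlusLogSqLaw.Octave
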